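import Literature.Topology.FourManifolds.Rasmussen
import Literature.Topology.FourManifolds.GaussDiagramsMirrorProofs
import Literature.Topology.FourManifolds.LeeRasmussenMirrorDischarge
import Literature.Topology.FourManifolds.KnotsMirrorProofs
import HarnessLib

/-!
# `s(K̄) = -s(K)` at knot level (discharge of `HasRasmussenInvariant.mirror`; sibling of `Rasmussen.lean`)

Sibling proof file of the statement file `Rasmussen.lean` for its named fact
`Literature.Topology.FourManifolds.HasRasmussenInvariant.mirror` — *"The Rasmussen invariant of the
mirror image is `s(K̄) = -s(K)`"* (J. Rasmussen, *Khovanov homology and the slice genus*, Invent.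
Math. 182 (2010) 419–447, §3.5 / proof of Thm. 2: Lee homology of the mirror is the filtered dual).
Everything here is **proved**; no definition and no named fact is introduced (D-0026).

The fact is the knot-level assembly of three theorems of the tree:

* the diagrammatic mirror formula `s(D.mirror) = -s(D)` for realisable Gauss diagrams
  (`GaussDiagram.rasmussenInvariant_mirror_holds`, `LeeRasmussenMirrorDischarge.lean`;
  Rasmussen 2010, §3.5);
* the geometric fact that the mirror image of a knot reading `D` is isotopic to a knot reading
  `D.mirror` (`Knot.HasGaussDiagram.mirror_holds`, `GaussDiagramsMirrorProofs.lean`;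
  Goussarov–Polyak–Viro 2000, §1.1, §1.4);
* compatibility of the mirror image with isotopy (`SphereEmbedding.IsIsotopic.mirror`,
  `KnotsMirrorProofs.lean`; Rolfsen 1976, §3.C) and transitivity of isotopy
  (`SphereEmbedding.IsotopyFacts`, instance of `KnotsIsotopyProofs.lean`).

Recall that `Knot.HasRasmussenInvariant K s` says that some knot `K'` isotopic to `K` has a Gauss
diagram `D` with `s(D) = s` (`LeeRasmussen.lean`); so from such a witness `(K', D)` for `K` one gets
the witness `(K'', D.mirror)` for `K.mirror`, where `K.mirror ≅ K'.mirror ≅ K''` and `K''` reads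
`D.mirror`.

## References

* J. Rasmussen, *Khovanov homology and the slice genus*, Invent. Math. 182 (2010) 419–447,
  §3.5 and proof of Thm. 2 (mirror image). [cite: Rasmussen2010, §3.5]
* M. Goussarov, M. Polyak, O. Viro, *Finite-type invariants of classical and virtual knots*,
  Topology 39 (2000) 1045–1068, §1.1, §1.4. [cite: GPV2000, §1.4]
* D. Rolfsen, *Knots and Links* (1976), §3.C. [cite: Rolfsen1976, §3.C]

## Design notes

No definitions, no named facts, no instances, no notation. The `[SphereEmbedding.SmoothnessFacts]`
argument of `HasRasmussenInvariant.mirror` / `Knot.mirror` is the instance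
`SphereEmbedding.smoothnessFacts` of `KnotsProofs.lean`.
-/

open Function Set

noncomputable section

namespace Literature.Topology.FourManifolds

/-- **Discharge of `HasRasmussenInvariant.mirror`: `s(K̄) = -s(K)`.** If `K` has Rasmussen
invariant `s` — witnessed by a knot `K' ≅ K` with a Gauss diagram `D`, `s(D) = s` — then
`K.mirror` has Rasmussen invariant `-s`: `K'.mirror` is isotopic to a knot `K''` reading `D.mirror`
(`Knot.HasGaussDiagram.mirror_holds`), `K.mirror ≅ K'.mirror ≅ K''`
(`SphereEmbedding.IsIsotopic.mirror`, transitivity), and `s(D.mirror) = -s(D)`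
(`GaussDiagram.rasmussenInvariant_mirror_holds`, `D` being realisable by `K'`).
Rasmussen (2010), §3.5 (mirror image), proof of Thm. 2. [cite: Rasmussen2010, §3.5] -/
theorem HasRasmussenInvariant.mirror_holds : HasRasmussenInvariant.mirror := by
  intro K s h
  obtain ⟨K', D, hKK', hD, hs⟩ := h
  obtain ⟨K'', hK'', hD''⟩ := Knot.HasGaussDiagram.mirror_holds hD
  refine ⟨K'', D.mirror, SphereEmbedding.IsotopyFacts.trans hKK'.mirror hK'', hD'', ?_⟩
  rw [GaussDiagram.rasmussenInvariant_mirror_holds ⟨K', hD⟩, hs]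

/-- `s(K̄) = -s(K)` in the two-sided form: `K.mirror` has Rasmussen invariant `s` iff `K` has
Rasmussen invariant `-s` (apply `HasRasmussenInvariant.mirror_holds` to `K` and to `K.mirror`,
`K.mirror.mirror = K`). Rasmussen (2010), §3.5. [cite: Rasmussen2010, §3.5] -/
theorem Knot.hasRasmussenInvariant_mirror_iff (K : Knot) (s : ℤ) :
    K.mirror.HasRasmussenInvariant s ↔ K.HasRasmussenInvariant (-s) := by
  constructor
  · intro h
    have h' := HasRasmussenInvariant.mirror_holds h
    rwa [show K.mirror.mirror = K from SphereEmbedding.mirror_mirror K] at h'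
  · intro h
    have h' := HasRasmussenInvariant.mirror_holds h
    rwa [neg_neg] at h'

end Literature.Topology.FourManifolds

end
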